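import Summits.QuantumFields.Balaban3D.Proofs.Inputs
import Summits.QuantumFields.Balaban3D.Proofs.Representation33
import Summits.QuantumFields.Balaban3D.Proofs.ChartThreshold
import Summits.QuantumFields.Balaban3D.Proofs.Thresholds
import Summits.QuantumFields.Balaban3D.Proofs.Newborn46

/-!
# Bałaban CMP 102 (1985), d = 3 lane — `Proofs.Primitives`: the PRIMITIVE constants of the (α) inputs (one record per group) and
# the lane's constants record `Inputs.LaneConsts` DEFINED from them — every step O(1) of `Constants.StepConsts` and the run O(1)'s
# `C46`, `z`, `aP` of `Constants.FamilyConsts` are the leaf seats' CLOSED EXPRESSIONS (R-CONST); the threshold `γ₀` is the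
# minimum of the seats' named thresholds (R-EPS0′) and the per-step smallness premises follow on the exhibited family `S.ε₀ = ε₀(S.g)`

Source: T. Bałaban, *Ultraviolet stability of three-dimensional lattice pure gauge field theories*, Commun. Math. Phys. **102** (1985)
255–275 [Balaban1985UV3] ([B10]; PDF page = journal page − 254): (7) p. 257, p. 262 L1–3 / L40, (25) p. 262, (28) p. 263, (44)–(45)
p. 267, p. 256 L15–18.  Lane `pub-balaban3d`, seat p3 (R-CONST / R-EPS0′ / R-NORM; LEAF-LEDGER C15, B7); the closed forms are seat
p6's (`Run3Representation`: `C₂, Cv, C₃, C₄, C₅, z`; `Newborn46`: `Cnew`), p5's (`Run3StepCumulant`/`Run3OldOutside`: `Cz, C₁, C₁', C₆, aP`), p2's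
(`Bound46Std`: `C46`); the thresholds are p6's `ChartThreshold.gamma28` ((28) smallness), p2's `Thresholds.gammaOf` ((45): `γ₄₆`;
p. 272: `γ_OO`).

WHAT PRINT FIXES AND WHAT IT LEAVES OPEN (fields with their printed conditions, except `b₀`, `p₀` which the lane DEFINES, R-E2′: «p₀ > 2
and b₀ is a sufficiently large absolute constant» ((7) p. 257) become `p₀ := 2r₀ + 1`, `b₀ := b₀(N, L, M₁, R₁, …)`; READING ⟦b₀ = b₀(N, L, …),
p₀ = 2r₀ + 1⟧): «κ₀ > 0» (p. 262 L3; `κ₀ < ½` located, LQB `rawConst7`), «R = R₁(1 + log g₀⁻¹)^{r₀}» ((7); `r₀ ≥ 1`, `R₁ ≥ 6 + 2κ₀` located,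
not printed), «M₁ sufficiently large» (p. 262 L40); the analyticity radius `ρ`, the (28) constant `cB`, the (25)/(63)/(45) amplitudes `C25`,
`C63`, `C45` with the per-block sum constant `CM` and the decay rate `κ` («κ can be arbitrarily large if M₁ is sufficiently large», p. 262
L40; LQB needs `κ ≥ κ₀(32,6) + 1`), the Loewner bounds and counts of the GAP binders G3D-04/05, the [B1] (3.24) constants `Ca, Cc` and
order `n̄`, the (44) constants `B₃, κ₁, C44`, the group constants `log σ₀`, `d(𝔤)`.
Nothing of the paper is asserted: a record of NAMES with sign conditions, definitions, and elementary positivity lemmas.  No `sorry`.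
-/

noncomputable section
namespace Summit.QuantumFields.Balaban3D.Proofs.Primitives

open Literature.MathematicalPhysics.QuantumFieldTheory.Balaban1983to89
open Literature.MathematicalPhysics.QuantumFieldTheory.Balaban1983to89.B10
open Literature.MathematicalPhysics.QuantumFieldTheory.Balaban1983to89.B10Assembly (rawConst7 rawConstR rawConst7_nonneg rawConstR_nonneg)
open Literature.MathematicalPhysics.QuantumFieldTheory.Balaban1983to89.B12TreeDecay (kappa₀ K₀ K₀_pos)
open Literature.MathematicalPhysics.QuantumFieldTheory.Balaban1985CMP102
open Literature.MathematicalPhysics.QuantumFieldTheory.Balaban1985CMP102.Setting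
open Summit.QuantumFields.Balaban3D.Carriers
open Summit.QuantumFields.Balaban3D.Proofs.ScalesArithmetic
open Summit.QuantumFields.Balaban3D.Proofs.Constants
open Summit.QuantumFields.Balaban3D.Proofs.Representation33 (ChartConsts)
open Summit.QuantumFields.Balaban3D.Proofs.Thresholds (gammaOf gammaOf_pos_le)
open Summit.QuantumFields.Balaban3D.Proofs.Inputs

variable {L : ℕ}

/-! ## §1 The primitive constants of one group -/

/-- **THE PRIMITIVE CONSTANTS OF THE (α) INPUTS** (one record per group as printed; every other constant of the lane is DEFINED from
it, §2).  Print's family parameters with their printed/located conditions: `κ₀ ∈ (0, ½)` (p. 262 L3; `< ½` located, LQB `rawConst7`),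
`M₁ ≥ 1` (p. 257), `r₀ ≥ 1`, `R₁ ≥ 6 + 2κ₀` ((7); located) — `b₀`, `p₀` of (7) are DEFINED in §2 (R-E2′) —; the group constants `log σ₀`
((18) p. 260), `d(𝔤)` ((22) p. 261); the chart constants of G3D-01/(28)/G3D-06/(63): radius `ρ > 0`, `cB ≥ 0`, per-block sum `CM ≥ 0`,
far constant `Cfar ≥ 0`, decay rate `κ ≥ κ₀(32,6) + 1`, amplitudes `0 ≤ C25`, `0 ≤ C63` with `C25·K₀ ≤ CM`, `C63·K₀ ≤ CM`; the Loewner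
bounds / counts of G3D-04 (`c35 > 0`, `a35`, `cv`, `cJ35`) and G3D-05 (`cT > 0`, `aT`, `cn ≥ 0`, `cJT ≥ 0`); the [B1] (3.24) constants
`Ca + Cc ≥ 0` and order `n̄`; the (44) constants `B₃ > 0`, `κ₁ > 0`, `C44 ≥ 0`; the (68) constant `C68 > 0`.  Parameters: the block
size `L` and the size `N` of the group's unitary model `U(N) ⊃ G` (only `b₀` depends on it).  Names only. [cite: Balaban1985UV3, (7) p.257 + p.262 + (25) p.262 + (28) p.263 + (44) p.267] -/
structure AlphaConsts (L N : ℕ) where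
  κ₀ : ℝ
  M₁ : ℕ
  r₀ : ℝ
  R₁ : ℝ
  logσ₀ : ℝ
  dimg : ℕ
  one_lt_L : 1 < L
  κ₀_pos : 0 < κ₀
  κ₀_lt_half : κ₀ < 1 / 2
  M₁_pos : 0 < M₁
  one_le_r₀ : 1 ≤ r₀
  R₁_ge : 6 + 2 * κ₀ ≤ R₁
  ρ : ℝ
  cB : ℝ
  CM : ℝ
  Cfar : ℝ
  κ : ℝ
  C25 : ℝ
  C63 : ℝ
  ρ_pos : 0 < ρ
  cB_nonneg : 0 ≤ cB
  CM_nonneg : 0 ≤ CM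
  Cfar_nonneg : 0 ≤ Cfar
  kappa_ge : kappa₀ (4 * 2 ^ 3) (2 * 3) + 1 ≤ κ
  C25_nonneg : 0 ≤ C25
  C25_le : C25 * K₀ (4 * 2 ^ 3) (2 * 3) ≤ CM
  C63_nonneg : 0 ≤ C63
  C63_le : C63 * K₀ (4 * 2 ^ 3) (2 * 3) ≤ CM
  c35 : ℝ
  a35 : ℝ
  cv : ℝ
  cJ35 : ℝ
  cT : ℝ
  aT : ℝ
  cn : ℝ
  cJT : ℝ
  c35_pos : 0 < c35
  cv_nonneg : 0 ≤ cv
  cJ35_nonneg : 0 ≤ cJ35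
  cT_pos : 0 < cT
  cn_nonneg : 0 ≤ cn
  cJT_nonneg : 0 ≤ cJT
  Ca : ℝ
  Cc : ℝ
  nbar : ℕ
  Cac_nonneg : 0 ≤ Ca + Cc
  B₃ : ℝ
  κ₁ : ℝ
  C44 : ℝ
  B₃_pos : 0 < B₃
  κ₁_pos : 0 < κ₁
  C44_nonneg : 0 ≤ C44
  /-- the O(1) of (68) p. 273 (local small-factor constant, seat p2's `C₁` of `B10Eq69Local`) -/
  C68 : ℝ
  C68_pos : 0 < C68
  /-- the O(1) `C45` of the GAP binder G3D-08 «(45) as cited» for the (61)-born pieces (tree `BindersNewborn.NewbornTerms45AsCited`) -/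
  C45 : ℝ
  C45_nonneg : 0 ≤ C45

namespace AlphaConsts

variable {N : ℕ} (𝔠 : AlphaConsts L N)

/-- `M₁ > 0` as a real. [folklore] -/
theorem M₁_pos_real : 0 < (𝔠.M₁ : ℝ) := by exact_mod_cast 𝔠.M₁_pos

/-! ## §2 The derived constants: chart profile, step O(1)'s, run O(1)'s, the lane's record -/

/-- Seat p6's chart-constant profile (`Representation33.ChartConsts`) with print's ONE exponent `r₀` of (7). [cite: Balaban1985UV3, (7) p.257 + (28) p.263] -/
def chart : ChartConsts where
  ρ := 𝔠.ρ
  cB := 𝔠.cB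
  r₀ := 𝔠.r₀
  CM := 𝔠.CM
  Cfar := 𝔠.Cfar
  ρ_pos := 𝔠.ρ_pos
  cB_nonneg := 𝔠.cB_nonneg
  r₀_nonneg := le_trans zero_le_one 𝔠.one_le_r₀
  CM_nonneg := 𝔠.CM_nonneg
  Cfar_nonneg := 𝔠.Cfar_nonneg

/-- `Cz := C25·K₀(32,6)` — the `O(g_k)|Z_k|` coefficient of (58)–(59) (p5 `cumulant58_series_v11`). [cite: Balaban1985UV3, (59) p.270] -/
def Cz : ℝ := 𝔠.C25 * K₀ (4 * 2 ^ 3) (2 * 3)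

/-- `C₁ := 0 + C25·K₀·e^{−R₁} + (Ca + 0 + Cc)` — the cumulant remainder constant (p5; `0` = the fluctuation-model constant of R-FL,
`C25·K₀·e^{−R₁}` = the large-localization part, `Ca + 0 + Cc` = the (3.24) constants with the re-expansion part vanishing). [cite: Balaban1985UV3, (58) p.270] -/
def C₁ : ℝ := 0 + 𝔠.C25 * K₀ (4 * 2 ^ 3) (2 * 3) * Real.exp (-𝔠.R₁) + (𝔠.Ca + 0 + 𝔠.Cc)

/-- `Cv := C25·K₀(32,6)` — the `O(g_k)|Z_k|` coefficient of the whole-lattice vacuum sum (p6 `vacuumWhole_series`). [cite: Balaban1985UV3, p.270 L30–31] -/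
def Cv : ℝ := 𝔠.C25 * K₀ (4 * 2 ^ 3) (2 * 3)

/-- `C₃ := rawConstR (C25·K₀) R₁ 1 κ₀` — the vacuum-sum remainder constant (p6). [cite: Balaban1985UV3, p.270 L32–33] -/
def C₃ : ℝ := rawConstR (𝔠.C25 * K₀ (4 * 2 ^ 3) (2 * 3)) 𝔠.R₁ 1 𝔠.κ₀

/-- `C₅ := cv·(log 2π + max(|log c35|, |log a35|))/2 + cJ35` — the (35) normalisation constant from G3D-04 (p6 `norm35_series`). [cite: Balaban1985UV3, (35) p.265] -/
def C₅ : ℝ := 𝔠.cv * ((Real.log (2 * Real.pi) + max |Real.log 𝔠.c35| |Real.log 𝔠.a35|) / 2) + 𝔠.cJ35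

/-- `C₆` — the p. 272 old-terms constant (p5 `oldOutside_series`): `(C44/2)·8M₁⁶·S(κ₁/2)·M₁⁻³·L/(L−1)`. [cite: Balaban1985UV3, p.272 L29–31] -/
def C₆ : ℝ := 𝔠.C44 / 2 * (8 * (𝔠.M₁ : ℝ) ^ 6)
  * (48 / (𝔠.κ₁ / 2) ^ 3 * Real.exp (𝔠.κ₁ / 2 / 2) / (1 - Real.exp (-(𝔠.κ₁ / 2 / 2)))) * (𝔠.M₁ : ℝ)⁻¹ ^ 3 * ((L : ℝ) / ((L : ℝ) - 1))

/-- `A := (Cz + Cv) + C₅ + C₆ + (|log σ₀| + d(𝔤))·3` — the per-site constant of the large-field exponent of row B25 (seat p2's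
`LargeFieldStd.lf_stdTowerInput`, proviso text E2-2; `3 = c₁` of the carrier record). [cite: Balaban1985UV3, pp.273–274] -/
def Alf : ℝ := (𝔠.Cz + 𝔠.Cv) + 𝔠.C₅ + 𝔠.C₆ + (|𝔠.logσ₀| + (𝔠.dimg : ℝ)) * 3

/-- `K_c := 2·(2(R₁+1)M₁ + 2(L·3(M₁−1) + 3(L−1)) + 20)` — seat p2's collar-count constant of the proviso text E2-2. [cite: Balaban1985UV3, (39)–(40) p.266] -/
def Kc : ℝ := 2 * (2 * ((𝔠.R₁ + 1) * 𝔠.M₁) + 2 * ((L : ℝ) * (3 * ((𝔠.M₁ : ℝ) - 1)) + 3 * ((L : ℝ) - 1)) + 20) * 1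

/-- **`b₀` DEFINED LARGE ENOUGH** (ruling R-E2′; print (7) p. 257 «b₀ is a sufficiently large absolute constant»):
`b₀ := √(4·max(N,1)·max(56, 8·A·K_c³/(½ log L)))`, so that the two provisos NOT IN PRINT of the large-field row B25 that mention the
group's `N` (`8·A·K_c³/(½ log L) ≤ b₀²/(4N)` and `56 ≤ b₀²/(4N)`, LQB GAP G-B10-10) HOLD BY DEFINITION (`Family.prov_hb₁/prov_hb₂`).
READING ⟦b₀ = b₀(N, L, M₁, R₁, κ₁, C44, C25, c35, a35, cv, cJ35, log σ₀, d(𝔤))⟧ — print's O(1) of (5) already depends on G and L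
(p. 257 L1, `d(𝔤)` in (62) p. 271); a reading, not a NOT-IN-PRINT conjunct. [cite: Balaban1985UV3, (7) p.257] -/
def b₀ : ℝ := Real.sqrt (4 * max (N : ℝ) 1 * max 56 (8 * (𝔠.Alf * 𝔠.Kc ^ 3 / (Real.log (L : ℝ) / 2))))

/-- **`p₀` DEFINED** (ruling R-E2′; print (7) p. 257 «p₀ > 2», `r₀` free): `p₀ := 2r₀ + 1 (≥ 3)`, so that the proviso NOT IN PRINT
`3r₀ + 2 ≤ 2p₀` of the chart power counting (LQB GAP G-B10-02) HOLDS BY DEFINITION (`prov_r₀p₀`). READING ⟦p₀ = 2r₀ + 1⟧. [cite: Balaban1985UV3, (7) p.257] -/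
def p₀ : ℝ := 2 * 𝔠.r₀ + 1

/-- `b₀ > 0`. [folklore] -/
theorem b₀_pos : 0 < 𝔠.b₀ := by unfold b₀; exact Real.sqrt_pos.2 (by positivity)

/-- `p₀ > 2` (print (7) p. 257 AS PRINTED). [cite: Balaban1985UV3, (7) p.257] -/
theorem two_lt_p₀ : 2 < 𝔠.p₀ := by have := 𝔠.one_le_r₀; unfold p₀; linarith

/-- `p₀ > 0`. [folklore] -/
theorem p₀_pos : 0 < 𝔠.p₀ := lt_trans two_pos 𝔠.two_lt_p₀

/-- `0 ≤ r₀ + p₀`. [folklore] -/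
theorem r₀_add_p₀_nonneg : 0 ≤ 𝔠.r₀ + 𝔠.p₀ := by linarith [𝔠.one_le_r₀, 𝔠.p₀_pos]

/-- `3r₀ + 2 ≤ 2p₀` (the proviso E2-1 NOT IN PRINT, LQB GAP G-B10-02 — by the definition of `p₀`). [folklore] -/
theorem prov_r₀p₀ : 𝔠.r₀ * 3 + 2 ≤ 2 * 𝔠.p₀ := by have := 𝔠.one_le_r₀; unfold p₀; linarith

/-- `Cnew := Cnew46 L chart C25 C63 C45 b₀ p₀` — the O(1) of the NEWBORN slice of (46), seat p6's CLOSED FORM (`Newborn46.newborn46_std`,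
R-46N′: from G3D-01/(28)/G3D-06 (C5), G3D-07 (C7), G3D-08). [cite: Balaban1985UV3, (45)–(46) p.267 + (33)–(34) p.264] -/
def Cnew : ℝ := Newborn46.Cnew46 L 𝔠.chart 𝔠.C25 𝔠.C63 𝔠.C45 𝔠.b₀ 𝔠.p₀

/-- `Cnew ≥ 0` (p6 `Cnew46_nonneg`). [folklore] -/
theorem Cnew_nonneg : 0 ≤ 𝔠.Cnew :=
  Newborn46.Cnew46_nonneg L 𝔠.chart 𝔠.C25_nonneg 𝔠.C63_nonneg 𝔠.C45_nonneg 𝔠.b₀_pos.le 𝔠.p₀_pos (lt_of_lt_of_le one_pos 𝔠.one_le_r₀)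

/-- `C₂ := rawConst7 Craw b₀ r₀ p₀ 1 κ₀` — the representation remainder constant of (33)/(60) (p6 `repr33_60_series`). [cite: Balaban1985UV3, (33) p.264] -/
def C₂ : ℝ := rawConst7 𝔠.chart.Craw 𝔠.b₀ 𝔠.r₀ 𝔠.p₀ 1 𝔠.κ₀

/-- `C₄ := rawConst7 Craw b₀ r₀ p₀ 1 κ₀ + rawConstR (2·C63·K₀) R₁ 1 κ₀` — the (35)/(61) remainder constant (p6 `decomp35_61_series`). [cite: Balaban1985UV3, (61) p.271] -/
def C₄ : ℝ := rawConst7 𝔠.chart.Craw 𝔠.b₀ 𝔠.r₀ 𝔠.p₀ 1 𝔠.κ₀ + rawConstR (2 * 𝔠.C63 * K₀ (4 * 2 ^ 3) (2 * 3)) 𝔠.R₁ 1 𝔠.κ₀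

/-- The full-rate torus constant `Z′(κ₁/M₁)` of seat p2's old-slice bound (46) (`Bound46Series`). [cite: Balaban1985UV3, (45)–(46) p.267] -/
def Zfull : ℝ := 2 / (𝔠.κ₁ / (𝔠.M₁ : ℝ)) * (24 * (48 / (𝔠.κ₁ / (𝔠.M₁ : ℝ) / 2) ^ 3
  * Real.exp (𝔠.κ₁ / (𝔠.M₁ : ℝ) / 2 / 2) / (1 - Real.exp (-(𝔠.κ₁ / (𝔠.M₁ : ℝ) / 2 / 2)))) * 1)

/-- `C46 := (2C44(8L²B₃Z′(κ₁/M₁))²·L⁴/(L−1) + Cnew)·M₁⁻³` — the O(1) of (46) = old slice (p2 `bound46_stdTowerInput`) + newborn slice (p6,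
R-46N). [cite: Balaban1985UV3, (46) p.267] -/
def C46 : ℝ := (2 * 𝔠.C44 * (8 * (L : ℝ) ^ 2 * 𝔠.B₃ * 𝔠.Zfull) ^ 2 * ((L : ℝ) ^ 4 / ((L : ℝ) - 1)) + 𝔠.Cnew) * ((𝔠.M₁ : ℝ)⁻¹) ^ 3

/-- `z := cn·(log 2π + max(|log cT|, |log aT|))/2 + cJT` — the O(1) of `|log Z^{(k)}(T₁^{(k)}, 1)| ≤ z|T₁^{(k)}|` from G3D-05 (p6). [cite: Balaban1985UV3, (65) p.273] -/
def z : ℝ := 𝔠.cn * ((Real.log (2 * Real.pi) + max |Real.log 𝔠.cT| |Real.log 𝔠.aT|) / 2) + 𝔠.cJT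

/-- `aP := C25·K₀(32,6)` — the O(1) of `|Σ_X 𝒫′_{k+1}(g_k, X, 1)| ≤ aP|T₁^{(k)}|` (p5 `pprT_le_series`). [cite: Balaban1985UV3, p.273 + (25) p.262] -/
def aP : ℝ := 𝔠.C25 * K₀ (4 * 2 ^ 3) (2 * 3)

/-- `C₁ ≥ 0`. [folklore] -/
theorem C₁_nonneg : 0 ≤ 𝔠.C₁ := by
  have hK : 0 < K₀ (4 * 2 ^ 3) (2 * 3) := K₀_pos _ _
  have h1 : 0 ≤ 𝔠.C25 * K₀ (4 * 2 ^ 3) (2 * 3) * Real.exp (-𝔠.R₁) :=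
    mul_nonneg (mul_nonneg 𝔠.C25_nonneg hK.le) (Real.exp_pos _).le
  have h2 := 𝔠.Cac_nonneg
  unfold C₁; linarith

/-- `C₂ ≥ 0`. [folklore] -/
theorem C₂_nonneg : 0 ≤ 𝔠.C₂ :=
  rawConst7_nonneg 𝔠.chart.Craw_nonneg 𝔠.b₀_pos.le 𝔠.r₀_add_p₀_nonneg one_pos 𝔠.κ₀_lt_half

/-- `C₃ ≥ 0`. [folklore] -/
theorem C₃_nonneg : 0 ≤ 𝔠.C₃ := rawConstR_nonneg (mul_nonneg 𝔠.C25_nonneg (K₀_pos _ _).le) one_pos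

/-- `C₄ ≥ 0`. [folklore] -/
theorem C₄_nonneg : 0 ≤ 𝔠.C₄ := by
  have h1 : (0 : ℝ) ≤ rawConst7 𝔠.chart.Craw 𝔠.b₀ 𝔠.r₀ 𝔠.p₀ 1 𝔠.κ₀ :=
    rawConst7_nonneg 𝔠.chart.Craw_nonneg 𝔠.b₀_pos.le 𝔠.r₀_add_p₀_nonneg one_pos 𝔠.κ₀_lt_half
  have h2 : (0 : ℝ) ≤ rawConstR (2 * 𝔠.C63 * K₀ (4 * 2 ^ 3) (2 * 3)) 𝔠.R₁ 1 𝔠.κ₀ :=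
    rawConstR_nonneg (by have := 𝔠.C63_nonneg; have := (K₀_pos (4 * 2 ^ 3) (2 * 3)).le; positivity) one_pos
  unfold C₄; linarith

/-- `Z_full > 0` (the torus shell constant of (46)). [folklore] -/
theorem Zfull_pos : 0 < 𝔠.Zfull := by
  have hM := 𝔠.M₁_pos_real
  have ha : 0 < 𝔠.κ₁ / (𝔠.M₁ : ℝ) := div_pos 𝔠.κ₁_pos hM
  have h1 : Real.exp (-(𝔠.κ₁ / (𝔠.M₁ : ℝ) / 2 / 2)) < 1 := Real.exp_lt_one_iff.2 (by linarith)
  have h2 : 0 < 1 - Real.exp (-(𝔠.κ₁ / (𝔠.M₁ : ℝ) / 2 / 2)) := by linarith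
  unfold Zfull; positivity

/-- `C46 ≥ 0`. [folklore] -/
theorem C46_nonneg : 0 ≤ 𝔠.C46 := by
  have hL : (1 : ℝ) < L := by exact_mod_cast 𝔠.one_lt_L
  have hL1 : 0 < (L : ℝ) - 1 := by linarith
  have := 𝔠.C44_nonneg; have := 𝔠.B₃_pos; have := 𝔠.Zfull_pos; have := 𝔠.M₁_pos_real; have := 𝔠.Cnew_nonneg
  unfold C46; positivity

/-- `C₅ ≥ 0`. [folklore] -/
theorem C₅_nonneg : 0 ≤ 𝔠.C₅ := by
  have h1 : 0 ≤ max |Real.log 𝔠.c35| |Real.log 𝔠.a35| := (abs_nonneg _).trans (le_max_left _ _)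
  have h2 := B10Eq35Norm.log_two_pi_nonneg
  have := 𝔠.cv_nonneg; have := 𝔠.cJ35_nonneg
  unfold C₅; positivity

/-- `C₆ ≥ 0`. [folklore] -/
theorem C₆_nonneg : 0 ≤ 𝔠.C₆ := by
  have hL : (1 : ℝ) < L := by exact_mod_cast 𝔠.one_lt_L
  have hL1 : 0 < (L : ℝ) - 1 := by linarith
  have h1 : Real.exp (-(𝔠.κ₁ / 2 / 2)) < 1 := Real.exp_lt_one_iff.2 (by linarith [𝔠.κ₁_pos])
  have h2 : 0 < 1 - Real.exp (-(𝔠.κ₁ / 2 / 2)) := by linarith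
  have := 𝔠.C44_nonneg; have := 𝔠.κ₁_pos; have := 𝔠.M₁_pos_real
  unfold C₆; positivity

/-- `z ≥ 0`. [folklore] -/
theorem z_nonneg : 0 ≤ 𝔠.z := by
  have h1 : 0 ≤ max |Real.log 𝔠.cT| |Real.log 𝔠.aT| := (abs_nonneg _).trans (le_max_left _ _)
  have h2 := B10Eq35Norm.log_two_pi_nonneg
  have := 𝔠.cn_nonneg; have := 𝔠.cJT_nonneg
  unfold z; positivity

/-- `a_P ≥ 0`. [folklore] -/
theorem aP_nonneg : 0 ≤ 𝔠.aP := mul_nonneg 𝔠.C25_nonneg (K₀_pos _ _).le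

/-- `Cz ≥ 0`. [folklore] -/
theorem Cz_nonneg : 0 ≤ 𝔠.Cz := mul_nonneg 𝔠.C25_nonneg (K₀_pos _ _).le

/-- `Cv ≥ 0`. [folklore] -/
theorem Cv_nonneg : 0 ≤ 𝔠.Cv := mul_nonneg 𝔠.C25_nonneg (K₀_pos _ _).le

/-- `R₁ ≥ 0`. [folklore] -/
theorem R₁_nonneg : 0 ≤ 𝔠.R₁ := by linarith [𝔠.R₁_ge, 𝔠.κ₀_pos]

/-- **THE STEP O(1)'s DEFINED** (`Constants.StepConsts` from the primitive constants; `C₁' := C₁`). [cite: Balaban1985UV3, (55)–(61) pp.269–271] -/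
def stepConsts : StepConsts where
  Cz := 𝔠.Cz
  C₁ := 𝔠.C₁
  C₁' := 𝔠.C₁
  C₂ := 𝔠.C₂
  Cv := 𝔠.Cv
  C₃ := 𝔠.C₃
  C₄ := 𝔠.C₄
  C₅ := 𝔠.C₅
  C₆ := 𝔠.C₆
  C₁_nonneg := 𝔠.C₁_nonneg
  C₂_nonneg := 𝔠.C₂_nonneg
  C₃_nonneg := 𝔠.C₃_nonneg
  C₄_nonneg := 𝔠.C₄_nonneg

/-- **THE FAMILY CONSTANTS DEFINED** (`Constants.FamilyConsts` from the primitive constants: `C46`, `z`, `aP` closed). [cite: Balaban1985UV3, (7) p.257 + (46) p.267 + (65) p.273] -/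
def familyConsts : FamilyConsts L where
  κ₀ := 𝔠.κ₀
  M₁ := 𝔠.M₁
  b₀ := 𝔠.b₀
  p₀ := 𝔠.p₀
  r₀ := 𝔠.r₀
  R₁ := 𝔠.R₁
  C46 := 𝔠.C46
  z := 𝔠.z
  aP := 𝔠.aP
  logσ₀ := 𝔠.logσ₀
  dimg := 𝔠.dimg
  one_lt_L := 𝔠.one_lt_L
  κ₀_pos := 𝔠.κ₀_pos
  M₁_pos := 𝔠.M₁_pos
  b₀_pos := 𝔠.b₀_pos
  two_lt_p₀ := 𝔠.two_lt_p₀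
  C46_nonneg := 𝔠.C46_nonneg
  z_nonneg := 𝔠.z_nonneg
  aP_nonneg := 𝔠.aP_nonneg

/-- **THE LANE'S CONSTANTS RECORD of the group** (`Inputs.LaneConsts`), DEFINED from the primitive constants. [cite: Balaban1985UV3, p.256 + p.257] -/
def lane : LaneConsts L := ⟨𝔠.familyConsts, 𝔠.stepConsts⟩

/-! ## §3 The threshold `γ₀` of the group and the per-step smallness premises on the exhibited family -/

/-- The (28)-smallness threshold `γ₂₈` (seat p6 `ChartThreshold.gamma28`). [cite: Balaban1985UV3, (28) p.263] -/
def gamma28 : ℝ := ChartThreshold.gamma28 𝔠.ρ 𝔠.cB 𝔠.r₀ 𝔠.b₀ 𝔠.p₀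

/-- The (45) threshold `γ₄₆ = gammaOf b₀ p₀ (1/(2·8L²B₃Z′(κ₁/M₁)))` («for g_{k−1} sufficiently small», seat p2 `Bound46Std`). [cite: Balaban1985UV3, (45) p.267] -/
def gamma46 : ℝ := gammaOf 𝔠.b₀ 𝔠.p₀ (1 / (2 * (8 * (L : ℝ) ^ 2 * 𝔠.B₃ * 𝔠.Zfull)))

/-- The torus constant `Z′` of seat p5's old-terms bound (p. 272). [cite: Balaban1985UV3, p.272 L29–31] -/
def Zprime : ℝ := 2 / (𝔠.κ₁ / (2 * (𝔠.M₁ : ℝ))) * (24 * (48 / (𝔠.κ₁ / (2 * (𝔠.M₁ : ℝ)) / 2) ^ 3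
  * Real.exp (𝔠.κ₁ / (2 * (𝔠.M₁ : ℝ)) / 2 / 2) / (1 - Real.exp (-(𝔠.κ₁ / (2 * (𝔠.M₁ : ℝ)) / 2 / 2)))) * 1)

/-- The p. 272 threshold `γ_OO = gammaOf b₀ p₀ (1/(2·8L²B₃Z′))` (seat p5 `oldOutside_series_gamma`). [cite: Balaban1985UV3, p.272 L29–31] -/
def gammaOO : ℝ := gammaOf 𝔠.b₀ 𝔠.p₀ (1 / (2 * (8 * (L : ℝ) ^ 2 * 𝔠.B₃ * 𝔠.Zprime)))

/-- The (71) threshold `γ₇₁ = gamma71L C68 L b₀ p₀` of the local small factor (seat p2 `Thresholds.gamma71L`, for row B25). [cite: Balaban1985UV3, (68)–(71) p.273] -/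
def gamma71 : ℝ := Thresholds.gamma71L 𝔠.C68 L 𝔠.b₀ 𝔠.p₀

/-- **THE GROUP'S THRESHOLD `γ₀ := min(1, γ₂₈, γ₄₆, γ_OO, γ₇₁)`** (R-EPS0′: `ε₀(g) = (min γ₀ 1)²/g²`). [cite: Balaban1985UV3, p.256 L15–18] -/
def gamma0 : ℝ := gammaMin [𝔠.gamma28, 𝔠.gamma46, 𝔠.gammaOO, 𝔠.gamma71]

/-- `Z′ > 0`. [folklore] -/
theorem Zprime_pos : 0 < 𝔠.Zprime := by
  have hM := 𝔠.M₁_pos_real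
  have ha : 0 < 𝔠.κ₁ / (2 * (𝔠.M₁ : ℝ)) := div_pos 𝔠.κ₁_pos (by positivity)
  have h1 : Real.exp (-(𝔠.κ₁ / (2 * (𝔠.M₁ : ℝ)) / 2 / 2)) < 1 := Real.exp_lt_one_iff.2 (by linarith)
  have h2 : 0 < 1 - Real.exp (-(𝔠.κ₁ / (2 * (𝔠.M₁ : ℝ)) / 2 / 2)) := by linarith
  unfold Zprime; positivity

/-- `γ₂₈ > 0`. [folklore] -/
theorem gamma28_pos : 0 < 𝔠.gamma28 :=
  ChartThreshold.gamma28_pos 𝔠.ρ_pos 𝔠.cB_nonneg 𝔠.b₀_pos.le (by linarith [𝔠.r₀_add_p₀_nonneg])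

/-- `γ₄₆ > 0`. [folklore] -/
theorem gamma46_pos : 0 < 𝔠.gamma46 := by
  have hL : (0 : ℝ) < L := by have := 𝔠.one_lt_L; exact_mod_cast (by omega : 0 < L)
  have hZ := 𝔠.Zfull_pos
  have := 𝔠.B₃_pos
  exact (gammaOf_pos_le 𝔠.b₀_pos 𝔠.p₀_pos (by positivity)).1

/-- `γ_OO > 0`. [folklore] -/
theorem gammaOO_pos : 0 < 𝔠.gammaOO := by
  have hL : (0 : ℝ) < L := by have := 𝔠.one_lt_L; exact_mod_cast (by omega : 0 < L)
  have := 𝔠.Zprime_pos; have := 𝔠.B₃_pos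
  exact (gammaOf_pos_le 𝔠.b₀_pos 𝔠.p₀_pos (by positivity)).1

/-- `γ₇₁ > 0`. [folklore] -/
theorem gamma71_pos : 0 < 𝔠.gamma71 :=
  (Thresholds.gamma71L_pos_le 𝔠.C68_pos 𝔠.one_lt_L.le 𝔠.b₀_pos 𝔠.p₀_pos).1

/-- `γ₀ > 0` (the positivity conjunct of the spine's `∃ eps0`). [folklore] -/
theorem gamma0_pos : 0 < 𝔠.gamma0 :=
  gammaMin_pos fun x hx => by
    simp only [List.mem_cons, List.mem_nil_iff, or_false] at hx
    rcases hx with rfl | rfl | rfl | rfl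
    · exact 𝔠.gamma28_pos
    · exact 𝔠.gamma46_pos
    · exact 𝔠.gammaOO_pos
    · exact 𝔠.gamma71_pos

end AlphaConsts

end Summit.QuantumFields.Balaban3D.Proofs.Primitives

end
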